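import Summits.Ventures.Crystal3D.Theorems.StickyWulffConstantCoaxialWallLawTwinAbsorption
import Summits.Ventures.Crystal3D.Theorems.StickyWulffConstantGenericWallFloorSharedTriangle
import HarnessLib

/-!
# The crude absorption inequality for a NON-co-axial pair (the face-twin pattern forces co-axiality)

HONEST FRAMING. Part of the venture `Summits/Ventures/Crystal3D` (cell `crystal3d-full`), helper
`--supports` the crux `CoaxialWallLaw` (stmt-Ventures-19481, `route-Ventures-StickyWulffConstant`),
line `WallLedgerF`; equally usable by the sister crux `GenericWallFloor` (stmt-Ventures-19480,
line `WallLedgerG`), whose pairs are NOT co-axial.  The second branch of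
`absorption_inPlane_or_faceTwin` (`…CoaxialWallLawTwinAbsorption`) puts a translate of a
triangular face of the host's slot shell on the foreign grain; two moved fcc lattices sharing
a unit triangle of DIFFERENCE vectors are co-axial (`coaxial_of_shared_triangle`,
`…GenericWallFloorSharedTriangle`, seat wulff-p2).  Hence:

* `nonCoaxial_absorption_inPlane` — host `Λ₀`, foreign `A·Λ₀ + t` NOT co-axial with `Λ₀`,
  `X ⊆ Λ₀ ∪ (A·Λ₀ + t)` a unit packing, `x ∈ Λ₀` off the foreign grain:
  `#{vacant in-plane slots of x} + 4 · deg_X(x) ≤ 48` — for EVERY choice of the hexagonal axis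
  of the host frame (the statement is about the model frame's `e₃`; re-presenting the host by a
  point-group element moves the axis).

WHAT THIS IS NOT: a riser count for non-co-axial pairs (their grains share no in-plane line
class; the G line uses the steepest class instead), anything about the cruxes' cells; rung F-C1
not moved.
-/

noncomputable section

namespace Summit.Ventures.Crystal3D.Theorems

open Summit.Ventures.Crystal3D Finset
open Literature.MathematicalPhysics.StatisticalMechanics (fccStacking barlowStacking IsHaggSeq)
open scoped InnerProductSpace

/-- **Crude absorption for a non-co-axial pair.**  See the module docstring. -/
theorem nonCoaxial_absorption_inPlane
    (A : EuclideanSpace ℝ (Fin 3) ≃ₗᵢ[ℝ] EuclideanSpace ℝ (Fin 3)) (t : EuclideanSpace ℝ (Fin 3))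
    (hnc : ¬ ∃ (L : EuclideanSpace ℝ (Fin 3) ≃ₗᵢ[ℝ] EuclideanSpace ℝ (Fin 3))
        (s₁ s₂ : EuclideanSpace ℝ (Fin 3)) (σ σ' : ℤ → ℤ), IsHaggSeq σ ∧ IsHaggSeq σ' ∧
        (fun p => (LinearIsometryEquiv.refl ℝ (EuclideanSpace ℝ (Fin 3))) p + 0) ''
            fccStacking 1 (Real.sqrt (2 / 3)) ⊆
          (fun p => L p + s₁) '' barlowStacking 1 (Real.sqrt (2 / 3)) σ ∧
        (fun p => A p + t) '' fccStacking 1 (Real.sqrt (2 / 3)) ⊆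
          (fun p => L p + s₂) '' barlowStacking 1 (Real.sqrt (2 / 3)) σ')
    (X : Finset (EuclideanSpace ℝ (Fin 3)))
    (hX : ∀ p ∈ X, ∀ q ∈ X, p ≠ q → 1 ≤ dist p q)
    (hXΛ : ∀ p ∈ X, p ∈ fccStacking 1 (Real.sqrt (2 / 3)) ∨
      p ∈ (fun q => A q + t) '' fccStacking 1 (Real.sqrt (2 / 3)))
    (x : EuclideanSpace ℝ (Fin 3)) (hxΛ : x ∈ fccStacking 1 (Real.sqrt (2 / 3)))
    (hxs : x ∉ (fun q => A q + t) '' fccStacking 1 (Real.sqrt (2 / 3))) :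
    (fccSlots.filter fun w => w 2 = 0 ∧ x + w ∉ X).card +
      4 * (X.filter fun y => dist x y = 1).card ≤ 48 := by
  rcases absorption_inPlane_or_faceTwin A t X hX hXΛ x hxΛ hxs with h | ⟨w₁, hw₁, w₂, hw₂, w₃, hw₃,
      -, -, -, d12, d13, d23, -, -, -, -, ⟨-, hτ₁⟩, ⟨-, hτ₂⟩, ⟨-, hτ₃⟩⟩
  · exact h
  exfalso
  apply hnc
  -- the shared unit triangle of difference vectors: `a = w₁ − w₂`, `b = w₁ − w₃`
  have hw₁Λ := mem_fcc_of_mem_fccSlots hw₁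
  have hw₂Λ := mem_fcc_of_mem_fccSlots hw₂
  have hw₃Λ := mem_fcc_of_mem_fccSlots hw₃
  have na : ‖w₁ - w₂‖ = 1 := by rw [← dist_eq_norm, d12]
  have nb : ‖w₁ - w₃‖ = 1 := by rw [← dist_eq_norm, d13]
  have nab : ⟪w₁ - w₂, w₁ - w₃⟫_ℝ = 1 / 2 := by
    have h1 : ‖(w₁ - w₂) - (w₁ - w₃)‖ = 1 := by
      rw [show (w₁ - w₂) - (w₁ - w₃) = w₃ - w₂ by abel, ← dist_eq_norm, dist_comm, d23]
    have h2 := norm_sub_sq_real (w₁ - w₂) (w₁ - w₃)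
    rw [h1, na, nb] at h2
    linarith
  have host : ∀ v : EuclideanSpace ℝ (Fin 3), v ∈ fccStacking 1 (Real.sqrt (2 / 3)) →
      v ∈ (fun p => (LinearIsometryEquiv.refl ℝ (EuclideanSpace ℝ (Fin 3))) p + 0) ''
        fccStacking 1 (Real.sqrt (2 / 3)) := fun v hv => ⟨v, hv, by simp⟩
  refine coaxial_of_shared_triangle (LinearIsometryEquiv.refl ℝ _) A 0 t x
    (x + ((2 / 3 : ℝ) • (w₁ + w₂ + w₃) - w₁)) (w₁ - w₂) (w₁ - w₃) (host x hxΛ) ?_ ?_ hτ₁ ?_ ?_ na nb nab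
  · exact host _ (by
      rw [show x + (w₁ - w₂) = x + w₁ - w₂ by abel]
      exact fcc_sub_site_mem (fcc_add_site_mem hxΛ hw₁Λ) hw₂Λ)
  · exact host _ (by
      rw [show x + (w₁ - w₃) = x + w₁ - w₃ by abel]
      exact fcc_sub_site_mem (fcc_add_site_mem hxΛ hw₁Λ) hw₃Λ)
  · rw [show x + ((2 / 3 : ℝ) • (w₁ + w₂ + w₃) - w₁) + (w₁ - w₂) =
        x + ((2 / 3 : ℝ) • (w₁ + w₂ + w₃) - w₂) by abel]
    exact hτ₂
  · rw [show x + ((2 / 3 : ℝ) • (w₁ + w₂ + w₃) - w₁) + (w₁ - w₃) =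
        x + ((2 / 3 : ℝ) • (w₁ + w₂ + w₃) - w₃) by abel]
    exact hτ₃

end Summit.Ventures.Crystal3D.Theorems

end
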